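import Mathlib
import Summits.KontsevichZagierPeriods.Zeta5Search.DenomLaw.LongProfiles16Path
import Summits.KontsevichZagierPeriods.Zeta5Search.DenomLaw.Profile15aPath
import Summits.KontsevichZagierPeriods.Zeta5Search.DenomLaw.Profile15dPath
import HarnessLib

/-!
# ζ(5) search — PATH ACCOUNTING FOR EVERY SORTED PARAMETER VECTOR ON THE FOURTEEN LONGEST FIRST-PERIOD PROFILES, IN ONE STATEMENT (`N_p ≥ 15`)

Cell `pub-zeta5` (HONEST FRAMING: systematic search; no irrationality claim unless certified), TRACK «DENOM-LAW» D1 prover seat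
(denom-prover-d1 g18, `HOME/denom-law/prover-d1/ATTEMPT-18.md` §2).  `FullProfile.pathAccountingFirstPeriod_long16` (this generation) extended by the four `N_p = 15`
profiles of a general sorted `b`: short blocks `{(1,2),…,(1,7)}` (`DenomLaw/Profile15aPath`: A⁗ / L5₈ with `C⋆ ≤ 10`, below `d = 3p`), `{(1,2),…,(1,6),(2,3)}`
(`DenomLaw/Profile15bPath`: Lemma-D / ORIGIN at `M = 6`), `{(1,2),…,(1,5),(2,3),(2,4)}` (`DenomLaw/Profile15cPath`: LB / double drop) and
`{(1,2),(1,3),(1,4),(2,3),(2,4),(3,4)}` (`DenomLaw/Profile15dPath`: Lemma-D / ORIGIN at `M = 6`).  The down-sets of short blocks with at most six elements are the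
ten of `N_p ≥ 16` and these four, so «at least 15 pair blocks reach `p`» reads: `b₀−b₂−b₃` reaches `p`, or (`b₀−b₁−b₇` and `b₀−b₂−b₄`), or (`b₀−b₁−b₆`, `b₀−b₂−b₅` and
`b₀−b₃−b₄`), or `b₀−b₁−b₅` reaches `p`.  **`pathAccountingFirstPeriod_long15`: the node, binders VERBATIM, plus `p ≤ b₇`, that disjunction, `d < 4p`, and
`d < 3p` whenever `b₀ − b₁ − b₅ < p`** (the open `3p ≤ d` cells of the branches `{12..15}`, `{12..16}`, `{12..17}` and the full profile's corner are what the last two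
hypotheses exclude).  Fourteen general-`b` profile theorems; no ray, no family.
MODEL/structure-side valuation bookkeeping of the cell's own rationals; nothing about ζ(5); no γ; records in print UNMOVED.
-/

namespace Summit.KontsevichZagierPeriods.Zeta5Search.FullProfile

open Summit.KontsevichZagierPeriods.Zeta5Search.CasoratianValuation (InPolytope shift casoratian pairFloors refund)
open Summit.KontsevichZagierPeriods.Zeta5Search.WedgeDictionary (dOf)
open Summit.KontsevichZagierPeriods.Zeta5Search.DenomLaw (cStar FirstPeriod Sorted7)
open Summit.KontsevichZagierPeriods.Zeta5Search.DenomLaw.FirstPeriodKit (sorted7_chain)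

/-- **`PathAccountingFirstPeriod`'s conclusion for EVERY sorted `b` on the profiles `N_p ≥ 15`, every direction `j`**: all seven parameters reach `p`, at
least 15 pair blocks reach `p` (`b₀−b₂−b₃ ≥ p`, or `b₀−b₁−b₇, b₀−b₂−b₄ ≥ p`, or `b₀−b₁−b₆, b₀−b₂−b₅, b₀−b₃−b₄ ≥ p`, or `b₀−b₁−b₅ ≥ p`), `d(b) < 4p`, and `d(b) < 3p` if
`b₀ − b₁ − b₅ < p`. -/
theorem pathAccounting_long15 (b : ℕ → ℤ) (j p : ℕ) (hb : InPolytope b) (hs : Sorted7 b) (hbj : InPolytope (shift b j))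
    (hj1 : 1 ≤ j) (hj7 : j ≤ 7) (hprime : p.Prime) (hp5 : 5 ≤ p) (hwin : (b 0 + 2 : ℤ) < (p : ℤ) ^ 2) (hfp : FirstPeriod b p)
    (hP : (p : ℤ) ≤ b 7)
    (hor : (p : ℤ) + b 2 + b 3 ≤ b 0 ∨ ((p : ℤ) + b 1 + b 7 ≤ b 0 ∧ (p : ℤ) + b 2 + b 4 ≤ b 0) ∨
      ((p : ℤ) + b 1 + b 6 ≤ b 0 ∧ (p : ℤ) + b 2 + b 5 ≤ b 0 ∧ (p : ℤ) + b 3 + b 4 ≤ b 0) ∨ (p : ℤ) + b 1 + b 5 ≤ b 0)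
    (hd4 : dOf b < 4 * (p : ℤ)) (hd3 : b 0 < (p : ℤ) + b 1 + b 5 → dOf b < 3 * (p : ℤ)) (hcas : casoratian b j ≠ 0) :
    dOf b / (p : ℤ) - pairFloors b p - min (if 2 ≤ dOf b / (p : ℤ) then (1 : ℤ) else 0) (5 - (cStar b p : ℤ))
      ≤ padicValRat p (casoratian b j) := by
  obtain ⟨h21, h32, h43, h54, h65, h76⟩ := sorted7_chain hs
  by_cases h16 : ((p : ℤ) + b 2 + b 3 ≤ b 0 ∧ (p : ℤ) + b 1 + b 7 ≤ b 0) ∨ ((p : ℤ) + b 1 + b 6 ≤ b 0 ∧ (p : ℤ) + b 2 + b 4 ≤ b 0) ∨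
      ((p : ℤ) + b 1 + b 5 ≤ b 0 ∧ (p : ℤ) + b 3 + b 4 ≤ b 0)
  · exact pathAccounting_long16 b j p hb hs hbj hj1 hj7 hprime hp5 hwin hfp hP h16 hd4 hd3 hcas
  · push Not at h16
    obtain ⟨h16a, h16b, h16c⟩ := h16
    rcases hor with h23 | ⟨h17, h24⟩ | ⟨h16', h25, h34⟩ | h15
    · -- short set `{12,…,17}`
      have h17 : b 0 < (p : ℤ) + b 1 + b 7 := by
        by_contra h; push Not at h; exact absurd h (not_le.2 (h16a h23))
      exact pathAccounting_profile15a b j p hb hs hbj hj1 hj7 hprime hp5 hwin hfp hP h17 h23 (hd3 (by linarith)) hcas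
    · -- short set `{12,…,16,23}`
      have h23 : b 0 < (p : ℤ) + b 2 + b 3 := by
        by_contra h; push Not at h; exact absurd h17 (not_le.2 (h16a h))
      have h16s : b 0 < (p : ℤ) + b 1 + b 6 := by
        by_contra h; push Not at h; exact absurd h24 (not_le.2 (h16b h))
      exact pathAccounting_profile15b b j p hb hs hbj hj1 hj7 hprime hp5 hwin hfp hP h16s h23 h17 h24 hcas
    · -- short set `{12,…,15,23,24}`
      have h24 : b 0 < (p : ℤ) + b 2 + b 4 := by
        by_contra h; push Not at h; exact absurd h (not_le.2 (h16b h16'))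
      have h15 : b 0 < (p : ℤ) + b 1 + b 5 := by
        by_contra h; push Not at h; exact absurd h34 (not_le.2 (h16c h))
      exact pathAccounting_profile15c b j p hb hs hbj hj1 hj7 hprime hp5 hwin hfp hP h15 h24 h16' h25 h34 hcas
    · -- short set `{12,13,14,23,24,34}`
      have h34 : b 0 < (p : ℤ) + b 3 + b 4 := by
        by_contra h; push Not at h; exact absurd h (not_le.2 (h16c h15))
      exact pathAccounting_profile15d b j p hb hs hbj hj1 hj7 hprime hp5 hwin hfp hP (by linarith) h34 h15 hcas

/-- **THE NODE FOR EVERY SORTED `b` ON THE PROFILES `N_p ≥ 15`: `PathAccountingFirstPeriod` with its binders VERBATIM plus `p ≤ b₇`, (`p + b₂ + b₃ ≤ b₀` ∨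
(`p + b₁ + b₇ ≤ b₀ ∧ p + b₂ + b₄ ≤ b₀`) ∨ (`p + b₁ + b₆ ≤ b₀ ∧ p + b₂ + b₅ ≤ b₀ ∧ p + b₃ + b₄ ≤ b₀`) ∨ `p + b₁ + b₅ ≤ b₀`) — all parameters and at least fifteen pair
blocks reach `p` —, `d(b) < 4p`, and `d(b) < 3p` whenever `b₀ < p + b₁ + b₅`.** -/
theorem pathAccountingFirstPeriod_long15 :
    ∀ (b : ℕ → ℤ) (p : ℕ), InPolytope b → Sorted7 b → InPolytope (shift b 7) →
      p.Prime → 5 ≤ p → (b 0 + 2 : ℤ) < (p : ℤ) ^ 2 → FirstPeriod b p → (p : ℤ) ≤ b 7 →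
      ((p : ℤ) + b 2 + b 3 ≤ b 0 ∨ ((p : ℤ) + b 1 + b 7 ≤ b 0 ∧ (p : ℤ) + b 2 + b 4 ≤ b 0) ∨
        ((p : ℤ) + b 1 + b 6 ≤ b 0 ∧ (p : ℤ) + b 2 + b 5 ≤ b 0 ∧ (p : ℤ) + b 3 + b 4 ≤ b 0) ∨ (p : ℤ) + b 1 + b 5 ≤ b 0) →
      dOf b < 4 * (p : ℤ) → (b 0 < (p : ℤ) + b 1 + b 5 → dOf b < 3 * (p : ℤ)) → casoratian b 7 ≠ 0 →
        dOf b / (p : ℤ) - pairFloors b p - min (if 2 ≤ dOf b / (p : ℤ) then (1 : ℤ) else 0) (5 - (cStar b p : ℤ))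
          ≤ padicValRat p (casoratian b 7) :=
  fun b p hb hs hb7 hprime hp5 hwin hfp hP hor hd4 hd3 hcas =>
    pathAccounting_long15 b 7 p hb hs hb7 (by norm_num) (by norm_num) hprime hp5 hwin hfp hP hor hd4 hd3 hcas

end Summit.KontsevichZagierPeriods.Zeta5Search.FullProfile
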